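import Summits.QuantumFields.QCD.Theses.SpectralDefectExtinction
import Summits.QuantumFields.QCD.Theorems.ExtinctionBuildsQCD.Negative.ExtinctIntegrable
import Summits.QuantumFields.QCD.Theorems.SpectralDefectExtinctionWindowExtinctionCornerStubSchurCount
import Literature.MathematicalPhysics.QuantumLattice.WilsonHopFlatSections
import Summits.QuantumFields.QCD.Theorems.SpectralDefectExtinctionWindowExtinctionCornerTwoLineDecay

/-!
# Line `corner-decorrelation-deep-hole` — skeleton for the crux `WindowExtinction` = SD⁺
# (stmt-QuantumFields-18063, route `SpectralDefectExtinction`)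

Crux-plan seat `planner-cruxplan-stmt-QuantumFields-18063-corner-decorrelation-0` (round 1, 2026-08-17),
from the crux idea `Cruxes/WindowExtinction/Ideas/corner-decorrelation-deep-hole.md` (ideator 2; triage r1-1
PASS, r1-2 PASS with the repair `L ≥ C₀√β`), the ideator's first-lemma file `SketchIdeator2R1.lean` §B, the
standing `Disproof.lean` (cycles 1–3; no `_false_without_` theorem, no `-- Targets` stub), the leads' verdicts
`CENSUS-S6-c1.md` / `Lines/Sketch_dead.md` / `Lines/Sketch_c3_handback.md`, and the crux-strategist's typed
split of `TipPricing` (`Cruxes/TipPricing/TipPricingSplit.lean`, TRUNK `TightCleanEdge` + WEGNER LEAF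
`CoercivityPricing`), whose binders are reused VERBATIM below so that this line docks with the route's declared
closing edge `TipPricing → WegnerEstimate → WindowExtinction` (`ExtinctionOfPricing`, proved).

## The lever (card) and what it buys

Write `K_U := 4·1 − D_W(U,0,1)` (Wilson hopping operator, `‖K_U‖ ≤ 4`).  SCHUR'S MAJORANT for the non-normal
matrix `K_Uⁿ` bounds the number of characteristic roots `z` of `D_W(U,0,1)` with `|4 − z| ≥ R` (real OR complex,
with multiplicity) by `‖K_Uⁿ‖_F² / R^{2n}` for EVERY gauge field (S1); `‖K_Uⁿ‖_F²` is, by Fubini, a spin-dressed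
sum of two-quark-line Wilson loops of length `2n`, and the card's one new estimate (S2, TWO-LINE DECAY) is that
its phase-quenched mean grows at rate `≤ 4 − c₁/β` up to path length `n ≤ β³` on tori of side `≥ C₀√β`
(single-link conditional contraction `‖E[U_ℓ | rest]‖ ≤ 1 − c/β`, uniform in the staple environment, acting
INSIDE the coherent `Σ_d P_d X P_d` recursion).  Chebyshev at `n = ⌊β_k³⌋` then empties the DEEP BAND
`{z : |4 − z| ≥ 4 − c₁/(2β_k)} ⊇ {real z ≤ c₁/(2β_k)}` per polynomial scheme volume (S3, bookkeeping under
asymptotic scaling + the cap).  No reflection positivity, no large deviations, no renormalisation group; odd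
`N_f` / split masses first-class.

## Architecture of `WindowExtinction_of` (honest scope)

The card is PARTIAL BY DESIGN (its `Transfer:` says "none of the crux as a whole"; both triagers concur): it
prices the deep band of EXTINCT (a) for EVERY admissible line, and says nothing about the near-edge band
`(c₁/(2β_k), −m_f(k))`, the Hermitian coercivity window (b), or TIGHT⁺.  The skeleton therefore follows the
consolidation the three leads and the 8967 strategist recommend (Sketch_c3_handback §3–4): the crux is the
conclusion of a TRUNK (one clean tight edge) and a WEGNER LEAF (coercivity pricing) plus the route item
`WegnerEstimate`; this line REMOVES THE DEEP BAND FROM THE TRUNK and supplies it by S1–S3: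

* S1 `stub_schurCount` — Schur majorant + Chebyshev, every gauge field (deterministic; provable now: Schur's
  inequality is LANDED as `Literature.Analysis.InnerProduct.matrix_sum_norm_sq_roots_charpoly_le`).
* S2 `stub_twoLineDecay` — THE LEVER: tilted (phase-quenched, `N_f ≤ 3`, masses `≥ −1`) annealed second
  moment of `K_Uⁿ` grows at rate `≤ 4 − c₁/β` for `1 ≤ n ≤ β³`, tori `2S+1 ≥ C₀√β` (triage r1-2 repair: on tori
  `≲ β^{1/2}` the whole torus is one cheap cold patch and the `∀ L` form is FALSE).  `N_f = 0` is pure gauge.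
  RESHAPED (lead c6, 2026-08-17) into S2a–S2e (§1): flat mass on resonant plaquettes · dense box from spread mass ·
  SINGLE-LINK RESONANCE ANTI-CONCENTRATION (the one probabilistic input, via the Wegner line's 1-D circle route) ·
  resonance large deviation on a box · assembly; S2 itself is proved from them in this file.
* S3 `stub_deepOfTwoLine` — S1 → S2-at-`N_f` → DEEP-BAND EXTINCTION along any asymptotically scaling, capped,
  branched regularisation (eventually `β_k ≥ 1`, `2L_k+1 ≥ C₀√β_k`, `m_f(k) ≥ −1`; `n = ⌊β_k³⌋`;
  `(2L_k+1)⁴ ≤ e^{O(p β_k)}` against `e^{−c₁β_k²/4}`; measurability of the closed-band root count).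
* S4 `stub_nearEdgeTightTrunk` — the TRUNK MINUS THE DEEP BAND: for every `δ > 0` a mass-scaling,
  asymptotically scaling, minimal-growth, branched regularisation whose line is a clean tight edge ABOVE depth
  `δ/β_k`: near-edge EXTINCT (a) (real modes in `(δ/β_k, −m_f(k))`) ∧ TIGHT⁺ (verbatim).  NOT this card's
  mechanism: it is the shared residue (C-E near-edge ∧ C-F) every previous line isolated (CENSUS-S6-c1 §0),
  typed to differ from the strategist's `TightCleanEdge` exactly by the deep band; docking port for the
  TIGHT⁺-side lines of this generation (variational-instanton-implant ⊕ uv-instanton-floor) and for DRESS.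
* S5 `stub_coercivityLeaf` — the strategist's WEGNER LEAF verbatim (`CoercivityPricing`-to-be):
  `WegnerEstimate →` at every clean tight edge the full EXTINCT (a)+(b) holds above some `M₁`, some `c > 0`.
* `windowExtinction_of_parts : S1 → S2 → S3 → S4 → S5 → WegnerEstimate → WindowExtinction` and
  `WindowExtinction_of (hW : WegnerEstimate) : WindowExtinction` (the stubs used by name) — PROVED here: take
  `c₁` from S2, the witness of S4 at `δ = c₁/2`, assemble the trunk's EXTINCT (a) from S3 (deep) + S4
  (near-edge) by a union bound in phase-quenched mean (multiset split + integrability of bounded measurable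
  counts × the continuous weight, `ExtinctIntegrable`), feed it to S5, read the cap exponent `p = 2` off minimal
  growth, raise the threshold to `M₁`.  `WegnerEstimate` (stmt-QuantumFields-8966) enters BY NAME.

All stub signatures are DEF-FREE (fully inlined over tree declarations), so each can be landed verbatim under
`Theorems/` with `--supports stmt-QuantumFields-18063`.

Disproof.lean honoured: §1 `norm_sub_le_four_of_mem_roots_charpoly_wilsonDirac` (`|4 − z| ≤ 4`: the deep
band is a band, never everything), Finding 1 (`extinctOnly_holds`: TIGHT⁺ is load-bearing — it sits in S4,
untouched by the lever), Findings 2/3 (`tight_pins_mcrit`, `window_realModes_ge`: the witness of S4 must be the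
physical edge; the lever never DEFINES `m_crit` — forbidden by the card, `Negative/NearTipBand`), Finding 6
(`coercivityDefect_of_near_root`: the Schur count sees complex roots, so the deep band is emptied of
near-eigenvalue discs too), Finding 10 (`p ≥ 2`: the composition uses `p = 2`), `windowConstant_le_one`
(`c` comes from S5, untouched).
-/

noncomputable section

namespace Summit.QuantumFields.QCD.Cruxes.WindowExtinction.CornerDecorrelationDeepHole

open scoped BigOperators Topology Classical Matrix
open Filter MeasureTheory
open Literature.MathematicalPhysics.QuantumLattice Literature.MathematicalPhysics.QuantumFieldTheory
  Literature.Probability.LatticeModels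
open Summit.QuantumFields.QCD.Theses.SpectralDefectExtinction
open Summit.QuantumFields.QCD.Theorems.ExtinctionBuildsQCD.Negative
  (integrable_mul_weight integrable_natCount_mul_weight countP_roots_charpoly_le_card)
open Summit.QuantumFields.QCD.Cruxes.TipPricing.HermitianFlowCoarea
  (countMeas_measurable_countP stub_countMeasurable)

/-! ## §1  The stubs

STATUS 2026-08-31 (leafhand g1): S1 and S2 (= S2a–S2e, incl. S2c p800732 and S2 p801891) LANDED and imported; S3 LANDED
(p147094) but kept sorried here until the farm serves its olean; open stubs = S4 `stub_nearEdgeTightTrunk`, S5 `stub_coercivityLeaf`. -/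

-- S1 `stub_schurCount` — LANDED p146544 (Theorems/SpectralDefectExtinctionWindowExtinctionCornerStubSchurCount.lean,
-- imported above).

/-! ### S2 `stub_twoLineDecay`, RESHAPED by lead c6 (2026-08-17) into five registered sub-stubs

S2 (the lever; registered signature kept verbatim below and PROVED from the sub-stubs) follows lead a2's
Lifshitz-tail architecture (`Lines/corner_decorrelation_deep_hole_S2_architecture.md`) with lead c5's single-link
pricing (`…_AC_reduction_SL_c5.md`), re-cut so that EVERY piece is Lean-sized:

* per column `q = (x,a,s)`: `Kⁿ e_q = (P_B K P_B)ⁿ e_q`, `B = ball(x,n)` (landed `pow_mulVec_eq_compressed_of_local`),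
  and Berger–Pearcy (landed `Literature.Analysis.InnerProduct.NumericalRadiusPower`): off the FLAT EVENT
  `F_θ(B) = {∃ ψ supported in B, |⟨ψ, K ψ⟩| > 4(1−θ)‖ψ‖²}` one has `‖Kⁿe_q‖² ≤ 4 (4(1−θ))^{2n}`, on it `≤ 16ⁿ`;
* S2a `stub_flatMassOnResonant` (deterministic): a θ-flat `ψ` is a flat covariant section (landed phase lemma +
  landed exact identity), its site norm has Dirichlet energy `≤ 32θ` (Kato), and by plaquette telescoping + normality
  of `ρ(U_P) ⊗ Rᵀ` (landed unitary resolvent / Kronecker lemmas) `≥ 3/4` of its mass sits on sites whose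
  `(0,1)`-plaquette has an eigenvalue within `√(2048θ)` of one of FOUR GRID PHASES `e^{ik_a√(512θ)}`;
* S2b `stub_denseBoxOfMass` (deterministic, generic): small Dirichlet energy + `3/4` of the mass on a site set `A`
  ⇒ some box of sides in `[ℓ, 2ℓ)` near the support has `≥ 1/4` of its sites in `A` (discrete Poincaré on boxes of a
  partition of the torus + pigeonhole; needs `ℓ² · energy ≤ 1/128`, `2ℓ ≤ L`);
* S2c `stub_singleLinkResonance` (THE probabilistic input, lead c6 holds it): under the single-link law
  `∝ ∏_f|det D_W| e^{−βS} dHaar(g)` of ONE link `(z,0) ↦ U(z,0)·g`, UNIFORMLY in the exterior, the masses and the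
  volume, the `(0,1)`-plaquette at `z` has an eigenvalue within `ε` of a given phase with probability
  `≤ C √β ε`.  Route (new, c6): NOT Weyl integration but the Wegner line's landed 1-D CIRCLE machinery
  (`…WegnerEstimate.ResolventCell`: slice lemma, Rodrigues circles, sorted-eigenvalue Lipschitz/a.e.-differentiability,
  cluster Hellmann–Feynman, Banach indicatrix, trigonometric zero count) applied to the Hermitian `3×3` family
  `Im(e^{−iφ₀} ρ(U_P))`, plus a pointwise `su(3)` rigidity inequality (`Σ_i |Im⟨(e^{−iφ₀}y)†v, X_i v⟩| ≥ c√(1 − s²)`)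
  and a 1-D "von Mises–Remez" lemma (`sup_t |P(t)|e^{κ cos t} ≤ C(deg P)√(1+κ) ⨍ |P|e^{κ cos}`) for the
  Boltzmann factor (degree 1 along a circle) and the `|det|` tilt (a trigonometric polynomial of degree `≤ 72`);
* S2d `stub_resonanceLD` (probability, from S2c by name): on a box of sides in `[ℓ,2ℓ)` with `2ℓ ≤ L`, the event
  "`≥ 1/16` of the sites are `ε`-resonant at phase `φ₀`", `ε ≤ √(κ₀/β)`, has phase-quenched probability
  `≤ C e^{−cℓ⁴}`: parity sublattices (the indicator at `y` sees only the links of `P_{01}(y)`, and `(y',0)` is one of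
  them only if `y' ∈ {y, y+1̂}`), sequential single-link resampling (slice lemma) + S2c ⇒ exponential-moment peeling
  `E[e^{λΣ}W] ≤ (1 + δ(e^λ−1))^M E[W]`, Markov;
* S2e `stub_twoLineAssembly` (bookkeeping): DET (= S2a+S2b glued below) and the conclusion of S2d give S2 with
  `θ = c₁/(4β)`, `ℓ ≍ √(β/c₁)`, a phase grid of `O(√β)` points and `O(β^{12}ℓ⁴)` boxes per column:
  `poly(β) 16ⁿ e^{−cℓ⁴} ≤ (4 − c₁/β)^{2n}` for `n ≤ β³` once `c₁` is small (`cℓ⁴ ≍ cβ²/c₁² ≫ c₁β²/2`).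
All statements are def-free and `:=`-free.  The old monolithic residual "(AC)/(QT₁)/(SL) not Lean-feasible"
(a2/c5) is superseded: S2c is its Lean-feasible form. -/

-- S2a `stub_flatMassOnResonant` — LANDED (Theorems/…CornerFlatMassOnResonant.lean; imported via …CornerTwoLineDecay).

-- S2b `stub_denseBoxOfMass` — LANDED (Theorems/…CornerDenseBoxOfMass.lean; imported).

-- S2c `stub_singleLinkResonance` — LANDED p800732 (leafhand g1; Theorems/…CornerSingleLinkResonance.lean, bricks
-- …CornerSingleLink{WeightSup,DetCircle,WilsonCircle,PhaseMatrix,HolonomyCircle}.lean; imported).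

-- S2d `stub_resonanceLD` — LANDED p797000 (leafhand g0; Theorems/…CornerResonanceLD.lean; imported).

-- S2e `stub_twoLineAssembly` — LANDED p796992 (leafhand g0; Theorems/…CornerTwoLineAssembly.lean; imported).

-- DET glue `flatDenseBox_of_stubs` — superseded by the landed `cornerTL_flatDenseBox` (p797291).

-- S2 `stub_twoLineDecay` — LANDED p801891 (leafhand g1; Theorems/…CornerTwoLineDecay.lean =
-- `twoLineDecay_of_singleLinkResonance stub_singleLinkResonance`; imported).

-- S3 `stub_deepOfTwoLine` — LANDED p147094 (lead a2; Theorems/SpectralDefectExtinctionWindowExtinctionCornerDeepOfTwoLine.lean).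
-- This PUBLISHED copy keeps the stub sorried only because the farm has not yet built a2's module (import pending);
-- the lead's working copy imports it.  Signature below = the REGISTERED `:=`-free form.
/-- **S3 · Deep-band extinction from two-line decay (bookkeeping + measurability; provable now).**  Given S1
and the conclusion of S2 at one `N_f ≤ 16` with constants `c₁, C, C₀`, every asymptotically scaling, polynomially
capped, branched regularisation `reg` empties the deep band in phase-quenched mean: for every mass tuple
`m > M₀ ≥ 0` and `ε > 0`, eventually in `k`, on every odd torus `2S+1 ≥ 2L_k+1`, the `|det|`-weighted expected
number of characteristic roots `z` of `D_W(U,0,1)` with `|4 − z| ≥ 4 − c₁/(2β_k)` is `≤ ε ((2S+1)/(2L_k+1))⁴`.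
Proof sketch: eventually `β_k ≥ 1` and `b₀ log(1/a_k) ≤ β_k ≤ 8b₀ log(1/a_k)` (`HasAsymptoticScaling`, `afBeta`,
`b₀ > 0` for `N_f ≤ 16`), `2L_k+1 ≥ 2/a_k ≥ C₀√β_k` (`tendsto_L`), `m_f(k) = m_crit(k) + a_k m_f/Z_k ≥ −1`
(branch, `a_k, Z_k, m_f > 0`); S1 pointwise with `R = 4 − c₁/(2β_k)`, `n = ⌊β_k³⌋`, integrate (the closed-band
count is measurable and `≤ 12(2S+1)⁴`, the weight continuous: `integrable_natCount_mul_weight`), apply S2: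
`E₊[count] ≤ C(2S+1)⁴((4 − c₁/β_k)/(4 − c₁/(2β_k)))^{2n} ≤ C(2S+1)⁴ e^{c₁/(4β_k)} e^{−c₁β_k²/4}`, and
`C(2L_k+1)⁴ e^{1} e^{−c₁β_k²/4} ≤ 81C a_k^{−4p} e^{−c₁β_k²/4} ≤ ε` eventually since `log(1/a_k) = O(β_k)`.
Size M/L.  (Card: `deepBandExtinct_of_twoLineDecayPQ`; triage r1-2 sharpen (1): the regime is non-empty only for
`β_k ≳ 66(1+θ)/c₁` — purely asymptotic, as it should be.) -/
theorem stub_deepOfTwoLine :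
    (∀ (L : ℕ) [NeZero L] (U : GaugeConfig 4 L ↥(Matrix.specialUnitaryGroup (Fin 3) ℂ)) (R : ℝ), 0 < R → ∀ n : ℕ, 1 ≤ n → (Multiset.countP (fun z : ℂ => R ≤ ‖(4 : ℂ) - z‖) (wilsonDirac (fundamentalRep (Fin 3)) U 0 1).charpoly.roots : ℝ) * R ^ (2 * n) ≤ (∑ i, ∑ j, ‖(((4 : ℂ) • (1 : Matrix (QuarkIdx L) (QuarkIdx L) ℂ) - wilsonDirac (fundamentalRep (Fin 3)) U 0 1) ^ n) i j‖ ^ 2)) → ∀ Nf : ℕ, Nf ≤ 16 → ∀ (reg : QCDRegularisation Nf) (c₁ C C₀ M₀ : ℝ), 0 < c₁ → 0 < C → 0 < C₀ → 0 ≤ M₀ → (reg.scheme 0 0 0).HasAsymptoticScaling → (∃ p : ℕ, ∀ᶠ k : ℕ in Filter.atTop, (reg.L k : ℝ) ≤ (reg.a k)⁻¹ ^ p) → (∀ᶠ k : ℕ in Filter.atTop, -1 < reg.mcrit k) → (∀ β : ℝ, 1 ≤ β → ∀ S : ℕ, C₀ * Real.sqrt β ≤ 2 * S + 1 → ∀ μ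 : Fin Nf → ℝ, (∀ f, -1 ≤ μ f) → ∀ n : ℕ, 1 ≤ n → (n : ℝ) ≤ β ^ 3 → (∫ U : GaugeConfig 4 (2 * S + 1) ↥(Matrix.specialUnitaryGroup (Fin 3) ℂ), (∑ i, ∑ j, ‖(((4 : ℂ) • (1 : Matrix (QuarkIdx (2 * S + 1)) (QuarkIdx (2 * S + 1)) ℂ) - wilsonDirac (fundamentalRep (Fin 3)) U 0 1) ^ n) i j‖ ^ 2) * ∏ f : Fin Nf, ‖fermionDet (wilsonDirac (fundamentalRep (Fin 3)) U (μ f) 1)‖ ∂(wilsonMeasure (fundamentalRep (Fin 3)) β)) / (∫ U : GaugeConfig 4 (2 * S + 1) ↥(Matrix.specialUnitaryGroup (Fin 3) ℂ), ∏ f : Fin Nf, ‖fermionDet (wilsonDirac (fundamentalRep (Fin 3)) U (μ f) 1)‖ ∂(wilsonMeasure (fundamentalRep (Fin 3)) β)) ≤ C * (2 * S + 1 : ℝ) ^ 4 * (4 - c₁ / β) ^ (2 * n)) → ∀ m : Fin Nf → ℝ, (∀ f, M₀ < m f) → ∀ ε : ℝ, 0 < ε → ∀ᶠ k : ℕ in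 Filter.atTop, ∀ S : ℕ, reg.L k ≤ S → (∫ U : GaugeConfig 4 (2 * S + 1) ↥(Matrix.specialUnitaryGroup (Fin 3) ℂ), (Multiset.countP (fun z : ℂ => 4 - c₁ / (2 * reg.β k) ≤ ‖(4 : ℂ) - z‖) (wilsonDirac (fundamentalRep (Fin 3)) U 0 1).charpoly.roots : ℝ) * ∏ f : Fin Nf, ‖fermionDet (wilsonDirac (fundamentalRep (Fin 3)) U (reg.mcrit k + reg.a k * m f / reg.Zm k) 1)‖ ∂(wilsonMeasure (fundamentalRep (Fin 3)) (reg.β k))) / (∫ U : GaugeConfig 4 (2 * S + 1) ↥(Matrix.specialUnitaryGroup (Fin 3) ℂ), ∏ f : Fin Nf, ‖fermionDet (wilsonDirac (fundamentalRep (Fin 3)) U (reg.mcrit k + reg.a k * m f / reg.Zm k) 1)‖ ∂(wilsonMeasure (fundamentalRep (Fin 3)) (reg.β k))) ≤ ε * ((2 * S + 1 : ℝ) / (2 * reg.L k + 1)) ^ 4 := by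
  sorry

/-- **S4 · NEAR-EDGE TIGHT TRUNK (the shared residue minus the deep band; NOT this card's mechanism).**  For
`N_f ∈ {2,3}` and EVERY depth constant `δ > 0` there is a mass-scaling, asymptotically scaling Wilson
regularisation of minimal volume growth (`L_k^q ≤ a_k^{−(q+1)}` eventually, every `q ≥ 1`), on the physical
branch, with a threshold `M₀ ≥ 0` above which, for every mass tuple: (near-edge EXTINCT (a)) the phase-quenched
expected number of REAL eigenvalues of `D_W(U,0,1)` in the band `(δ/β_k, −m_f(k))` is `≤ ε` per scheme torus on
all tori at least the scheme's, eventually in `k`; and (TIGHT⁺, verbatim) the phase-quenched mean absolute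
spectral index just past the line is `≥ max 1 (η (a_k(2L_k+1))²)`.  This is the crux-strategist's TRUNK
`TightCleanEdge` (binder `hT` of `Cruxes/TipPricing/TipPricingSplit.lean`, child-to-be of stmt-QuantumFields-8967)
with its EXTINCT (a) clause restricted to depths `> δ/β_k`; the witness may depend on `δ`.  Content = the two
YM-grade inputs every line on this crux isolated (CENSUS-S6-c1 §0; FloorNecessary p141124 makes (F) NECESSARY):
(E′) a sharp real-mode accumulation edge at a configuration-independent `−m_crit(k) ≈ 0.87/β_k` down to depth
`δ/β_k` (DRESS: Krein-definite persistence + tadpole-form concentration — crux idea `krein-definite-dressing`;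
no card of this generation), (F) the asymptotic-scaling floor of the phase-quenched topological susceptibility
with anti-concentration (gen-1 cards variational-instanton-implant ⊕ uv-instanton-floor reach it up to
`(log 1/a_k)^{−C}`, triage §X(2)).  Honest status: conjecture-grade / open-problem; a lead should NOT hold it
(CENSUS-S6-c1 §5) — it is the docking port, to be discharged by name once the planner files `TightCleanEdge`
(which implies it for every `δ`). -/
theorem stub_nearEdgeTightTrunk :
    ∀ Nf : ℕ, (Nf = 2 ∨ Nf = 3) → ∀ δ : ℝ, 0 < δ → ∃ reg : QCDRegularisation Nf, reg.HasMassScaling ∧ (reg.scheme 0 0 0).HasAsymptoticScaling ∧ (∀ q : ℕ, 0 < q → ∀ᶠ k : ℕ in Filter.atTop, (reg.L k : ℝ) ^ q ≤ (reg.a k)⁻¹ ^ (q + 1)) ∧ (∀ᶠ k : ℕ in Filter.atTop, -1 < reg.mcrit k) ∧ ∃ M₀ : ℝ, 0 ≤ M₀ ∧ ∀ m : Fin Nf → ℝ, (∀ f, M₀ < m f) → (∀ ε : ℝ, 0 < ε → ∀ᶠ k : ℕ in Filter.atTop, ∀ S : ℕ, reg.L k ≤ S → (∫ U : GaugeConfig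 4 (2 * S + 1) ↥(Matrix.specialUnitaryGroup (Fin 3) ℂ), (∑ f : Fin Nf, (Multiset.countP (fun z : ℂ => z.im = 0 ∧ δ / reg.β k < z.re ∧ z.re < -(reg.mcrit k + reg.a k * m f / reg.Zm k)) (wilsonDirac (fundamentalRep (Fin 3)) U 0 1).charpoly.roots : ℝ)) * ∏ f : Fin Nf, ‖fermionDet (wilsonDirac (fundamentalRep (Fin 3)) U (reg.mcrit k + reg.a k * m f / reg.Zm k) 1)‖ ∂(wilsonMeasure (fundamentalRep (Fin 3)) (reg.β k))) / (∫ U : GaugeConfig 4 (2 * S + 1) ↥(Matrix.specialUnitaryGroup (Fin 3) ℂ), ∏ f : Fin Nf, ‖fermionDet (wilsonDirac (fundamentalRep (Fin 3)) U (reg.mcrit k + reg.a k * m f / reg.Zm k) 1)‖ ∂(wilsonMeasure (fundamentalRep (Fin 3)) (reg.β k))) ≤ ε * ((2 * S + 1 : ℝ) / (2 * reg.L k + 1)) ^ 4) ∧ (∃ η : ℝ, 0 < η ∧ ∀ M : ℝ, M₀ < M → ∀ᶠ k : ℕ in Filter.atTop, max 1 (η * (reg.a k * (2 * reg.L k + 1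 : ℝ)) ^ 2) ≤ (∫ U : GaugeConfig 4 (2 * reg.L k + 1) ↥(Matrix.specialUnitaryGroup (Fin 3) ℂ), (|(Multiset.countP (fun z : ℂ => z.re < 0) (spinorLift gammaFive * wilsonDirac (fundamentalRep (Fin 3)) U (reg.mcrit k - reg.a k * M / reg.Zm k) 1).charpoly.roots : ℝ) - 6 * (2 * reg.L k + 1 : ℝ) ^ 4|) * ∏ f : Fin Nf, ‖fermionDet (wilsonDirac (fundamentalRep (Fin 3)) U (reg.mcrit k + reg.a k * m f / reg.Zm k) 1)‖ ∂(wilsonMeasure (fundamentalRep (Fin 3)) (reg.β k))) / (∫ U : GaugeConfig 4 (2 * reg.L k + 1) ↥(Matrix.specialUnitaryGroup (Fin 3) ℂ), ∏ f : Fin Nf, ‖fermionDet (wilsonDirac (fundamentalRep (Fin 3)) U (reg.mcrit k + reg.a k * m f / reg.Zm k) 1)‖ ∂(wilsonMeasure (fundamentalRep (Fin 3)) (reg.β k)))) := by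
  sorry

/-- **S5 · WEGNER LEAF = coercivity pricing (verbatim the crux-strategist's binder `hB`,
`Cruxes/TipPricing/TipPricingSplit.lean`; child-to-be `CoercivityPricing` of stmt-QuantumFields-8967).**
`WegnerEstimate →` for every mass-scaling, asymptotically scaling, minimal-growth, branched regularisation and
threshold `M₀` at which EXTINCT (a) and TIGHT⁺ hold for all `m > M₀`, there are `M₁ ≥ M₀` and `c > 0` such that
the full EXTINCT clause (a)+(b) of `WindowExtinction` holds for all `m > M₁`: the Hermitian coercivity window
`(−c a_k m_f/Z_k, c a_k m_f/Z_k)` of `γ₅ D_W(U, m_f(k), 1)` is priced at a clean tight edge by the Wegner /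
landing law (route items #4/#5: `WegnerEstimate`, `TipPricing`; `c ≤ 1` necessarily, `windowConstant_le_one`).
Why it might fail: the quenched Wegner bound is linear in the window but EXTENSIVE (`C(1+β^p)·ε·L⁴`), so
clause (b) at density `o(a_k⁴)` per site needs the clean edge to control slow (Krein-indefinite) flow lines of
`H_W(m)` hovering near zero without crossing — pair-creation near-misses (KVZ `a²W₈`); size open (shared with
8967's line `coercivity-at-clean-edge`). -/
theorem stub_coercivityLeaf :
    WegnerEstimate → ∀ Nf : ℕ, (Nf = 2 ∨ Nf = 3) → ∀ reg : QCDRegularisation Nf, reg.HasMassScaling → (reg.scheme 0 0 0).HasAsymptoticScaling → (∀ q : ℕ, 0 < q → ∀ᶠ k : ℕ in Filter.atTop, (reg.L k : ℝ) ^ q ≤ (reg.a k)⁻¹ ^ (q + 1)) → (∀ᶠ k : ℕ in Filter.atTop, -1 < reg.mcrit k) → ∀ M₀ : ℝ, 0 ≤ M₀ → (∀ m : Fin Nf → ℝ, (∀ f, M₀ < m f) → (∀ ε : ℝ, 0 < ε → ∀ᶠ k : ℕ in Filter.atTop, ∀ S : ℕ, reg.L k ≤ S → (∫ U : GaugeConfig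 4 (2 * S + 1) ↥(Matrix.specialUnitaryGroup (Fin 3) ℂ), (∑ f : Fin Nf, (Multiset.countP (fun z : ℂ => z.im = 0 ∧ z.re < -(reg.mcrit k + reg.a k * m f / reg.Zm k)) (wilsonDirac (fundamentalRep (Fin 3)) U 0 1).charpoly.roots : ℝ)) * ∏ f : Fin Nf, ‖fermionDet (wilsonDirac (fundamentalRep (Fin 3)) U (reg.mcrit k + reg.a k * m f / reg.Zm k) 1)‖ ∂(wilsonMeasure (fundamentalRep (Fin 3)) (reg.β k))) / (∫ U : GaugeConfig 4 (2 * S + 1) ↥(Matrix.specialUnitaryGroup (Fin 3) ℂ), ∏ f : Fin Nf, ‖fermionDet (wilsonDirac (fundamentalRep (Fin 3)) U (reg.mcrit k + reg.a k * m f / reg.Zm k) 1)‖ ∂(wilsonMeasure (fundamentalRep (Fin 3)) (reg.β k))) ≤ ε * ((2 * S + 1 : ℝ) / (2 * reg.L k + 1)) ^ 4) ∧ (∃ η : ℝ, 0 < η ∧ ∀ M : ℝ, M₀ < M → ∀ᶠ k : ℕ in Filter.atTop, max 1 (η * (reg.a k * (2 * reg.L k + 1 : ℝ)) ^ 2) ≤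 (∫ U : GaugeConfig 4 (2 * reg.L k + 1) ↥(Matrix.specialUnitaryGroup (Fin 3) ℂ), (|(Multiset.countP (fun z : ℂ => z.re < 0) (spinorLift gammaFive * wilsonDirac (fundamentalRep (Fin 3)) U (reg.mcrit k - reg.a k * M / reg.Zm k) 1).charpoly.roots : ℝ) - 6 * (2 * reg.L k + 1 : ℝ) ^ 4|) * ∏ f : Fin Nf, ‖fermionDet (wilsonDirac (fundamentalRep (Fin 3)) U (reg.mcrit k + reg.a k * m f / reg.Zm k) 1)‖ ∂(wilsonMeasure (fundamentalRep (Fin 3)) (reg.β k))) / (∫ U : GaugeConfig 4 (2 * reg.L k + 1) ↥(Matrix.specialUnitaryGroup (Fin 3) ℂ), ∏ f : Fin Nf, ‖fermionDet (wilsonDirac (fundamentalRep (Fin 3)) U (reg.mcrit k + reg.a k * m f / reg.Zm k) 1)‖ ∂(wilsonMeasure (fundamentalRep (Fin 3)) (reg.β k))))) → ∃ M₁ : ℝ, M₀ ≤ M₁ ∧ ∃ c : ℝ, 0 < c ∧ ∀ m : Fin Nf → ℝ, (∀ f, M₁ < m f) → (∀ ε : ℝ, 0 < ε → ∀ᶠ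 k : ℕ in Filter.atTop, ∀ S : ℕ, reg.L k ≤ S → (∫ U : GaugeConfig 4 (2 * S + 1) ↥(Matrix.specialUnitaryGroup (Fin 3) ℂ), ((∑ f : Fin Nf, ((Multiset.countP (fun z : ℂ => z.im = 0 ∧ z.re < -(reg.mcrit k + reg.a k * m f / reg.Zm k)) (wilsonDirac (fundamentalRep (Fin 3)) U 0 1).charpoly.roots : ℝ) + (Multiset.countP (fun z : ℂ => |z.re| < c * (reg.a k * m f / reg.Zm k)) (spinorLift gammaFive * wilsonDirac (fundamentalRep (Fin 3)) U (reg.mcrit k + reg.a k * m f / reg.Zm k) 1).charpoly.roots : ℝ)))) * ∏ f : Fin Nf, ‖fermionDet (wilsonDirac (fundamentalRep (Fin 3)) U (reg.mcrit k + reg.a k * m f / reg.Zm k) 1)‖ ∂(wilsonMeasure (fundamentalRep (Fin 3)) (reg.β k))) / (∫ U : GaugeConfig 4 (2 * S + 1) ↥(Matrix.specialUnitaryGroup (Fin 3) ℂ), ∏ f : Fin Nf, ‖fermionDet (wilsonDirac (fundamentalRep (Fin 3)) U (reg.mcrit k + reg.a k * m f / reg.Zm k) 1)‖ ∂(wilsonMeasure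 (fundamentalRep (Fin 3)) (reg.β k))) ≤ ε * ((2 * S + 1 : ℝ) / (2 * reg.L k + 1)) ^ 4) := by
  sorry

/-! ## §2  Tools for the composition (proved) -/

/-- Multiset union bound: if `p ⇒ q ∨ r` pointwise then `#p ≤ #q + #r`. -/
theorem countP_le_countP_add_countP {α : Type*} (s : Multiset α) (p q r : α → Prop)
    [DecidablePred p] [DecidablePred q] [DecidablePred r] (h : ∀ a, p a → q a ∨ r a) :
    s.countP p ≤ s.countP q + s.countP r := by
  induction s using Multiset.induction_on with
  | empty => simp
  | cons a s ih =>
    rw [Multiset.countP_cons, Multiset.countP_cons, Multiset.countP_cons]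
    by_cases hp : p a
    · rcases h a hp with hq | hr
      · rw [if_pos hp, if_pos hq]; split_ifs <;> omega
      · rw [if_pos hp, if_pos hr]; split_ifs <;> omega
    · rw [if_neg hp]; split_ifs <;> omega

/-- The split of the EXTINCT (a) predicate: a real root below `T` lies in the deep band `|4 − z| ≥ 4 − t`
(if `re z ≤ t`) or in the near-edge band `t < re z < T`. -/
theorem realBelow_imp_deep_or_near (t T : ℝ) (z : ℂ) (hz : z.im = 0 ∧ z.re < T) :
    (4 - t ≤ ‖(4 : ℂ) - z‖) ∨ (z.im = 0 ∧ t < z.re ∧ z.re < T) := by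
  by_cases hle : z.re ≤ t
  · left
    have h1 : ((4 : ℂ) - z).re = 4 - z.re := by simp
    calc 4 - t ≤ 4 - z.re := by linarith
      _ = ((4 : ℂ) - z).re := h1.symm
      _ ≤ ‖(4 : ℂ) - z‖ := Complex.re_le_norm _
  · exact Or.inr ⟨hz.1, lt_of_not_ge hle, hz.2⟩

/-- The deep-band root count `U ↦ #{roots z of charpoly D_W(U,0,1) : 4 − t ≤ |4 − z|}` is measurable (closed
predicate, continuous matrix: `countMeas_measurable_countP`). -/
theorem measurable_deepCount (L : ℕ) [NeZero L] (t : ℝ) :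
    Measurable fun U : GaugeConfig 4 L ↥(Matrix.specialUnitaryGroup (Fin 3) ℂ) =>
      Multiset.countP (fun z : ℂ => 4 - t ≤ ‖(4 : ℂ) - z‖)
        (wilsonDirac (fundamentalRep (Fin 3)) U 0 1).charpoly.roots := by
  have hA : Continuous fun U : GaugeConfig 4 L ↥(Matrix.specialUnitaryGroup (Fin 3) ℂ) =>
      wilsonDirac (fundamentalRep (Fin 3)) U 0 1 :=
    continuous_wilsonDirac _ (continuous_fundamentalRep (Fin 3)) 0 1
  exact countMeas_measurable_countP hA (fun z : ℂ => 4 - t ≤ ‖(4 : ℂ) - z‖)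
    (fun _ => {z : ℂ | 4 - t ≤ ‖(4 : ℂ) - z‖})
    (fun _ => isClosed_le continuous_const (continuous_const.sub continuous_id).norm)
    (fun _ _ _ => le_rfl) (fun z => ⟨fun h => ⟨0, h⟩, fun ⟨_, h⟩ => h⟩)

/-- **Union bound in phase-quenched mean.**  If `0 ≤ A ≤ n·D + N` pointwise, the weight `w ≥ 0`, `D·w` and
`N·w` are integrable, and the `w`-weighted ratios of `D`, `N` are `≤ ε₁V`, `≤ ε₂V` with `n ε₁ + ε₂ ≤ ε`, then the
ratio of `A` is `≤ εV` (the case `∫ w = 0` is the junk value `x/0 = 0`). -/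
theorem ratio_le_of_split {X : Type*} [MeasurableSpace X] (μ : Measure X)
    {A D N w : X → ℝ} {V ε₁ ε₂ ε n : ℝ}
    (hw : ∀ x, 0 ≤ w x) (hA : ∀ x, 0 ≤ A x) (hAle : ∀ x, A x ≤ n * D x + N x)
    (hDi : Integrable (fun x => D x * w x) μ) (hNi : Integrable (fun x => N x * w x) μ)
    (hD : (∫ x, D x * w x ∂μ) / (∫ x, w x ∂μ) ≤ ε₁ * V)
    (hN : (∫ x, N x * w x ∂μ) / (∫ x, w x ∂μ) ≤ ε₂ * V)
    (hn : 0 ≤ n) (hV : 0 ≤ V) (hε0 : 0 ≤ ε) (hε : n * ε₁ + ε₂ ≤ ε) :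
    (∫ x, A x * w x ∂μ) / (∫ x, w x ∂μ) ≤ ε * V := by
  have hZ0 : 0 ≤ ∫ x, w x ∂μ := integral_nonneg hw
  rcases hZ0.eq_or_lt with hZ | hZ
  · rw [← hZ, div_zero]
    exact mul_nonneg hε0 hV
  · have hmono : ∫ x, A x * w x ∂μ ≤ ∫ x, (n * (D x * w x) + N x * w x) ∂μ := by
      refine integral_mono_of_nonneg (Eventually.of_forall fun x => mul_nonneg (hA x) (hw x))
        ((hDi.const_mul n).add hNi) (Eventually.of_forall fun x => ?_)
      have h1 := mul_le_mul_of_nonneg_right (hAle x) (hw x)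
      calc A x * w x ≤ (n * D x + N x) * w x := h1
        _ = n * (D x * w x) + N x * w x := by ring
    have hsplit : ∫ x, (n * (D x * w x) + N x * w x) ∂μ =
        n * ∫ x, D x * w x ∂μ + ∫ x, N x * w x ∂μ := by
      rw [integral_add (hDi.const_mul n) hNi, integral_const_mul]
    have hD' := (div_le_iff₀ hZ).1 hD
    have hN' := (div_le_iff₀ hZ).1 hN
    rw [div_le_iff₀ hZ]
    calc ∫ x, A x * w x ∂μ ≤ n * ∫ x, D x * w x ∂μ + ∫ x, N x * w x ∂μ := hmono.trans_eq hsplit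
      _ ≤ n * (ε₁ * V * ∫ x, w x ∂μ) + ε₂ * V * ∫ x, w x ∂μ :=
          add_le_add (mul_le_mul_of_nonneg_left hD' hn) hN'
      _ = (n * ε₁ + ε₂) * V * ∫ x, w x ∂μ := by ring
      _ ≤ ε * V * ∫ x, w x ∂μ :=
          mul_le_mul_of_nonneg_right (mul_le_mul_of_nonneg_right hε hV) hZ.le

/-! ## §3  The composition -/

/-- **The composition as a closed implication (statements of S1–S5 as hypotheses, `WegnerEstimate` by name).**
Take `(c₁, C, C₀)` from S2 and the witness `reg` of S4 at depth `δ = c₁/2`; S3 (fed with S1 and S2 at `N_f`)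
empties the deep band `|4 − z| ≥ 4 − c₁/(2β_k)`, which contains every real root `≤ c₁/(2β_k)`; a union bound in
phase-quenched mean with S4's near-edge clause gives the trunk's EXTINCT (a) for `reg`; S5 with `WegnerEstimate`
returns the full EXTINCT (a)+(b) above `M₁ ≥ M₀` with some `c > 0`; the cap exponent is `p = 2` (minimal growth
at `q = 1`), the branch clause and TIGHT⁺ (probes `M > M₁`) come from S4. -/
theorem windowExtinction_of_parts
    (h₁ : ∀ (L : ℕ) [NeZero L] (U : GaugeConfig 4 L ↥(Matrix.specialUnitaryGroup (Fin 3) ℂ)) (R : ℝ), 0 < R → ∀ n : ℕ, 1 ≤ n → (Multiset.countP (fun z : ℂ => R ≤ ‖(4 : ℂ) - z‖) (wilsonDirac (fundamentalRep (Fin 3)) U 0 1).charpoly.roots : ℝ) * R ^ (2 * n) ≤ (∑ i, ∑ j, ‖(((4 : ℂ) • (1 : Matrix (QuarkIdx L) (QuarkIdx L) ℂ) - wilsonDirac (fundamentalRep (Fin 3)) U 0 1) ^ n) i j‖ ^ 2))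
    (h₂ : ∃ c₁ C C₀ : ℝ, 0 < c₁ ∧ 0 < C ∧ 0 < C₀ ∧ ∀ Nf : ℕ, Nf ≤ 3 → ∀ β : ℝ, 1 ≤ β → ∀ S : ℕ, C₀ * Real.sqrt β ≤ 2 * S + 1 → ∀ μ : Fin Nf → ℝ, (∀ f, -1 ≤ μ f) → ∀ n : ℕ, 1 ≤ n → (n : ℝ) ≤ β ^ 3 → (∫ U : GaugeConfig 4 (2 * S + 1) ↥(Matrix.specialUnitaryGroup (Fin 3) ℂ), (∑ i, ∑ j, ‖(((4 : ℂ) • (1 : Matrix (QuarkIdx (2 * S + 1)) (QuarkIdx (2 * S + 1)) ℂ) - wilsonDirac (fundamentalRep (Fin 3)) U 0 1) ^ n) i j‖ ^ 2) * ∏ f : Fin Nf, ‖fermionDet (wilsonDirac (fundamentalRep (Fin 3)) U (μ f) 1)‖ ∂(wilsonMeasure (fundamentalRep (Fin 3)) β)) / (∫ U : GaugeConfig 4 (2 * S + 1) ↥(Matrix.specialUnitaryGroup (Fin 3) ℂ), ∏ f : Fin Nf, ‖fermionDet (wilsonDirac (fundamentalRep (Fin 3)) U (μ f) 1)‖ ∂(wilsonMeasure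 (fundamentalRep (Fin 3)) β)) ≤ C * (2 * S + 1 : ℝ) ^ 4 * (4 - c₁ / β) ^ (2 * n))
    (h₃ : (∀ (L : ℕ) [NeZero L] (U : GaugeConfig 4 L ↥(Matrix.specialUnitaryGroup (Fin 3) ℂ)) (R : ℝ), 0 < R → ∀ n : ℕ, 1 ≤ n → (Multiset.countP (fun z : ℂ => R ≤ ‖(4 : ℂ) - z‖) (wilsonDirac (fundamentalRep (Fin 3)) U 0 1).charpoly.roots : ℝ) * R ^ (2 * n) ≤ (∑ i, ∑ j, ‖(((4 : ℂ) • (1 : Matrix (QuarkIdx L) (QuarkIdx L) ℂ) - wilsonDirac (fundamentalRep (Fin 3)) U 0 1) ^ n) i j‖ ^ 2)) → ∀ Nf : ℕ, Nf ≤ 16 → ∀ (reg : QCDRegularisation Nf) (c₁ C C₀ M₀ : ℝ), 0 < c₁ → 0 < C → 0 < C₀ → 0 ≤ M₀ → (reg.scheme 0 0 0).HasAsymptoticScaling → (∃ p : ℕ, ∀ᶠ k : ℕ in Filter.atTop, (reg.L k : ℝ) ≤ (reg.a k)⁻¹ ^ p) → (∀ᶠ k : ℕ in Filter.atTop, -1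 < reg.mcrit k) → (∀ β : ℝ, 1 ≤ β → ∀ S : ℕ, C₀ * Real.sqrt β ≤ 2 * S + 1 → ∀ μ : Fin Nf → ℝ, (∀ f, -1 ≤ μ f) → ∀ n : ℕ, 1 ≤ n → (n : ℝ) ≤ β ^ 3 → (∫ U : GaugeConfig 4 (2 * S + 1) ↥(Matrix.specialUnitaryGroup (Fin 3) ℂ), (∑ i, ∑ j, ‖(((4 : ℂ) • (1 : Matrix (QuarkIdx (2 * S + 1)) (QuarkIdx (2 * S + 1)) ℂ) - wilsonDirac (fundamentalRep (Fin 3)) U 0 1) ^ n) i j‖ ^ 2) * ∏ f : Fin Nf, ‖fermionDet (wilsonDirac (fundamentalRep (Fin 3)) U (μ f) 1)‖ ∂(wilsonMeasure (fundamentalRep (Fin 3)) β)) / (∫ U : GaugeConfig 4 (2 * S + 1) ↥(Matrix.specialUnitaryGroup (Fin 3) ℂ), ∏ f : Fin Nf, ‖fermionDet (wilsonDirac (fundamentalRep (Fin 3)) U (μ f) 1)‖ ∂(wilsonMeasure (fundamentalRep (Fin 3)) β)) ≤ C * (2 * S + 1 : ℝ) ^ 4 * (4 - c₁ / β) ^ (2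 * n)) → ∀ m : Fin Nf → ℝ, (∀ f, M₀ < m f) → ∀ ε : ℝ, 0 < ε → ∀ᶠ k : ℕ in Filter.atTop, ∀ S : ℕ, reg.L k ≤ S → (∫ U : GaugeConfig 4 (2 * S + 1) ↥(Matrix.specialUnitaryGroup (Fin 3) ℂ), (Multiset.countP (fun z : ℂ => 4 - c₁ / (2 * reg.β k) ≤ ‖(4 : ℂ) - z‖) (wilsonDirac (fundamentalRep (Fin 3)) U 0 1).charpoly.roots : ℝ) * ∏ f : Fin Nf, ‖fermionDet (wilsonDirac (fundamentalRep (Fin 3)) U (reg.mcrit k + reg.a k * m f / reg.Zm k) 1)‖ ∂(wilsonMeasure (fundamentalRep (Fin 3)) (reg.β k))) / (∫ U : GaugeConfig 4 (2 * S + 1) ↥(Matrix.specialUnitaryGroup (Fin 3) ℂ), ∏ f : Fin Nf, ‖fermionDet (wilsonDirac (fundamentalRep (Fin 3)) U (reg.mcrit k + reg.a k * m f / reg.Zm k) 1)‖ ∂(wilsonMeasure (fundamentalRep (Fin 3)) (reg.β k))) ≤ ε * ((2 * S + 1 : ℝ) / (2 * reg.L k + 1)) ^ 4)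
    (h₄ : ∀ Nf : ℕ, (Nf = 2 ∨ Nf = 3) → ∀ δ : ℝ, 0 < δ → ∃ reg : QCDRegularisation Nf, reg.HasMassScaling ∧ (reg.scheme 0 0 0).HasAsymptoticScaling ∧ (∀ q : ℕ, 0 < q → ∀ᶠ k : ℕ in Filter.atTop, (reg.L k : ℝ) ^ q ≤ (reg.a k)⁻¹ ^ (q + 1)) ∧ (∀ᶠ k : ℕ in Filter.atTop, -1 < reg.mcrit k) ∧ ∃ M₀ : ℝ, 0 ≤ M₀ ∧ ∀ m : Fin Nf → ℝ, (∀ f, M₀ < m f) → (∀ ε : ℝ, 0 < ε → ∀ᶠ k : ℕ in Filter.atTop, ∀ S : ℕ, reg.L k ≤ S → (∫ U : GaugeConfig 4 (2 * S + 1) ↥(Matrix.specialUnitaryGroup (Fin 3) ℂ), (∑ f : Fin Nf, (Multiset.countP (fun z : ℂ => z.im = 0 ∧ δ / reg.β k < z.re ∧ z.re < -(reg.mcrit k + reg.a k * m f / reg.Zm k)) (wilsonDirac (fundamentalRep (Fin 3)) U 0 1).charpoly.roots : ℝ)) * ∏ f : Fin Nf, ‖fermionDet (wilsonDirac (fundamentalRep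 (Fin 3)) U (reg.mcrit k + reg.a k * m f / reg.Zm k) 1)‖ ∂(wilsonMeasure (fundamentalRep (Fin 3)) (reg.β k))) / (∫ U : GaugeConfig 4 (2 * S + 1) ↥(Matrix.specialUnitaryGroup (Fin 3) ℂ), ∏ f : Fin Nf, ‖fermionDet (wilsonDirac (fundamentalRep (Fin 3)) U (reg.mcrit k + reg.a k * m f / reg.Zm k) 1)‖ ∂(wilsonMeasure (fundamentalRep (Fin 3)) (reg.β k))) ≤ ε * ((2 * S + 1 : ℝ) / (2 * reg.L k + 1)) ^ 4) ∧ (∃ η : ℝ, 0 < η ∧ ∀ M : ℝ, M₀ < M → ∀ᶠ k : ℕ in Filter.atTop, max 1 (η * (reg.a k * (2 * reg.L k + 1 : ℝ)) ^ 2) ≤ (∫ U : GaugeConfig 4 (2 * reg.L k + 1) ↥(Matrix.specialUnitaryGroup (Fin 3) ℂ), (|(Multiset.countP (fun z : ℂ => z.re < 0) (spinorLift gammaFive * wilsonDirac (fundamentalRep (Fin 3)) U (reg.mcrit k - reg.a k * M / reg.Zm k) 1).charpoly.roots : ℝ) - 6 * (2 * reg.L k + 1 : ℝ) ^ 4|)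 * ∏ f : Fin Nf, ‖fermionDet (wilsonDirac (fundamentalRep (Fin 3)) U (reg.mcrit k + reg.a k * m f / reg.Zm k) 1)‖ ∂(wilsonMeasure (fundamentalRep (Fin 3)) (reg.β k))) / (∫ U : GaugeConfig 4 (2 * reg.L k + 1) ↥(Matrix.specialUnitaryGroup (Fin 3) ℂ), ∏ f : Fin Nf, ‖fermionDet (wilsonDirac (fundamentalRep (Fin 3)) U (reg.mcrit k + reg.a k * m f / reg.Zm k) 1)‖ ∂(wilsonMeasure (fundamentalRep (Fin 3)) (reg.β k)))))
    (h₅ : WegnerEstimate → ∀ Nf : ℕ, (Nf = 2 ∨ Nf = 3) → ∀ reg : QCDRegularisation Nf, reg.HasMassScaling → (reg.scheme 0 0 0).HasAsymptoticScaling → (∀ q : ℕ, 0 < q → ∀ᶠ k : ℕ in Filter.atTop, (reg.L k : ℝ) ^ q ≤ (reg.a k)⁻¹ ^ (q + 1)) → (∀ᶠ k : ℕ in Filter.atTop, -1 < reg.mcrit k) → ∀ M₀ : ℝ, 0 ≤ M₀ → (∀ m : Fin Nf → ℝ, (∀ f, M₀ < m f) → (∀ ε : ℝ, 0 < ε → ∀ᶠ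 k : ℕ in Filter.atTop, ∀ S : ℕ, reg.L k ≤ S → (∫ U : GaugeConfig 4 (2 * S + 1) ↥(Matrix.specialUnitaryGroup (Fin 3) ℂ), (∑ f : Fin Nf, (Multiset.countP (fun z : ℂ => z.im = 0 ∧ z.re < -(reg.mcrit k + reg.a k * m f / reg.Zm k)) (wilsonDirac (fundamentalRep (Fin 3)) U 0 1).charpoly.roots : ℝ)) * ∏ f : Fin Nf, ‖fermionDet (wilsonDirac (fundamentalRep (Fin 3)) U (reg.mcrit k + reg.a k * m f / reg.Zm k) 1)‖ ∂(wilsonMeasure (fundamentalRep (Fin 3)) (reg.β k))) / (∫ U : GaugeConfig 4 (2 * S + 1) ↥(Matrix.specialUnitaryGroup (Fin 3) ℂ), ∏ f : Fin Nf, ‖fermionDet (wilsonDirac (fundamentalRep (Fin 3)) U (reg.mcrit k + reg.a k * m f / reg.Zm k) 1)‖ ∂(wilsonMeasure (fundamentalRep (Fin 3)) (reg.β k))) ≤ ε * ((2 * S + 1 : ℝ) / (2 * reg.L k + 1)) ^ 4) ∧ (∃ η : ℝ, 0 < η ∧ ∀ M : ℝ, M₀ < M → ∀ᶠ k : ℕ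 in Filter.atTop, max 1 (η * (reg.a k * (2 * reg.L k + 1 : ℝ)) ^ 2) ≤ (∫ U : GaugeConfig 4 (2 * reg.L k + 1) ↥(Matrix.specialUnitaryGroup (Fin 3) ℂ), (|(Multiset.countP (fun z : ℂ => z.re < 0) (spinorLift gammaFive * wilsonDirac (fundamentalRep (Fin 3)) U (reg.mcrit k - reg.a k * M / reg.Zm k) 1).charpoly.roots : ℝ) - 6 * (2 * reg.L k + 1 : ℝ) ^ 4|) * ∏ f : Fin Nf, ‖fermionDet (wilsonDirac (fundamentalRep (Fin 3)) U (reg.mcrit k + reg.a k * m f / reg.Zm k) 1)‖ ∂(wilsonMeasure (fundamentalRep (Fin 3)) (reg.β k))) / (∫ U : GaugeConfig 4 (2 * reg.L k + 1) ↥(Matrix.specialUnitaryGroup (Fin 3) ℂ), ∏ f : Fin Nf, ‖fermionDet (wilsonDirac (fundamentalRep (Fin 3)) U (reg.mcrit k + reg.a k * m f / reg.Zm k) 1)‖ ∂(wilsonMeasure (fundamentalRep (Fin 3)) (reg.β k))))) → ∃ M₁ : ℝ, M₀ ≤ M₁ ∧ ∃ c : ℝ, 0 < c ∧ ∀ m :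 Fin Nf → ℝ, (∀ f, M₁ < m f) → (∀ ε : ℝ, 0 < ε → ∀ᶠ k : ℕ in Filter.atTop, ∀ S : ℕ, reg.L k ≤ S → (∫ U : GaugeConfig 4 (2 * S + 1) ↥(Matrix.specialUnitaryGroup (Fin 3) ℂ), ((∑ f : Fin Nf, ((Multiset.countP (fun z : ℂ => z.im = 0 ∧ z.re < -(reg.mcrit k + reg.a k * m f / reg.Zm k)) (wilsonDirac (fundamentalRep (Fin 3)) U 0 1).charpoly.roots : ℝ) + (Multiset.countP (fun z : ℂ => |z.re| < c * (reg.a k * m f / reg.Zm k)) (spinorLift gammaFive * wilsonDirac (fundamentalRep (Fin 3)) U (reg.mcrit k + reg.a k * m f / reg.Zm k) 1).charpoly.roots : ℝ)))) * ∏ f : Fin Nf, ‖fermionDet (wilsonDirac (fundamentalRep (Fin 3)) U (reg.mcrit k + reg.a k * m f / reg.Zm k) 1)‖ ∂(wilsonMeasure (fundamentalRep (Fin 3)) (reg.β k))) / (∫ U : GaugeConfig 4 (2 * S + 1) ↥(Matrix.specialUnitaryGroup (Fin 3) ℂ), ∏ f : Fin Nf, ‖fermionDet (wilsonDirac (fundamentalRep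 (Fin 3)) U (reg.mcrit k + reg.a k * m f / reg.Zm k) 1)‖ ∂(wilsonMeasure (fundamentalRep (Fin 3)) (reg.β k))) ≤ ε * ((2 * S + 1 : ℝ) / (2 * reg.L k + 1)) ^ 4))
    (hW : WegnerEstimate) : WindowExtinction := by
  intro Nf hNf
  obtain ⟨c₁, C, C₀, hc₁, hC, hC₀, hlev⟩ := h₂
  have hNf3 : Nf ≤ 3 := by rcases hNf with rfl | rfl <;> norm_num
  have hNf16 : Nf ≤ 16 := hNf3.trans (by norm_num)
  obtain ⟨reg, hms, has, hgr, hbr, M₀, hM₀, hTm⟩ := h₄ Nf hNf (c₁ / 2) (half_pos hc₁)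
  have hcap : ∃ p : ℕ, ∀ᶠ k : ℕ in Filter.atTop, (reg.L k : ℝ) ≤ (reg.a k)⁻¹ ^ p := by
    refine ⟨2, ?_⟩
    filter_upwards [hgr 1 one_pos] with k hk
    simpa using hk
  have hdeep := h₃ h₁ Nf hNf16 reg c₁ C C₀ M₀ hc₁ hC hC₀ hM₀ has hcap hbr (hlev Nf hNf3)
  -- the trunk's EXTINCT (a) ∧ TIGHT⁺ for `reg`, assembled from the deep band (S3) and the near-edge band (S4)
  have hTrunk : ∀ m : Fin Nf → ℝ, (∀ f, M₀ < m f) → (∀ ε : ℝ, 0 < ε → ∀ᶠ k : ℕ in Filter.atTop, ∀ S : ℕ, reg.L k ≤ S → (∫ U : GaugeConfig 4 (2 * S + 1) ↥(Matrix.specialUnitaryGroup (Fin 3) ℂ), (∑ f : Fin Nf, (Multiset.countP (fun z : ℂ => z.im = 0 ∧ z.re < -(reg.mcrit k + reg.a k * m f / reg.Zm k)) (wilsonDirac (fundamentalRep (Fin 3)) U 0 1).charpoly.roots : ℝ)) * ∏ f : Fin Nf, ‖fermionDet (wilsonDirac (fundamentalRep (Fin 3)) U (reg.mcrit k + reg.a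 k * m f / reg.Zm k) 1)‖ ∂(wilsonMeasure (fundamentalRep (Fin 3)) (reg.β k))) / (∫ U : GaugeConfig 4 (2 * S + 1) ↥(Matrix.specialUnitaryGroup (Fin 3) ℂ), ∏ f : Fin Nf, ‖fermionDet (wilsonDirac (fundamentalRep (Fin 3)) U (reg.mcrit k + reg.a k * m f / reg.Zm k) 1)‖ ∂(wilsonMeasure (fundamentalRep (Fin 3)) (reg.β k))) ≤ ε * ((2 * S + 1 : ℝ) / (2 * reg.L k + 1)) ^ 4) ∧ (∃ η : ℝ, 0 < η ∧ ∀ M : ℝ, M₀ < M → ∀ᶠ k : ℕ in Filter.atTop, max 1 (η * (reg.a k * (2 * reg.L k + 1 : ℝ)) ^ 2) ≤ (∫ U : GaugeConfig 4 (2 * reg.L k + 1) ↥(Matrix.specialUnitaryGroup (Fin 3) ℂ), (|(Multiset.countP (fun z : ℂ => z.re < 0) (spinorLift gammaFive * wilsonDirac (fundamentalRep (Fin 3)) U (reg.mcrit k - reg.a k * M / reg.Zm k) 1).charpoly.roots : ℝ) - 6 * (2 * reg.L k + 1 : ℝ) ^ 4|) * ∏ f : Fin Nf, ‖fermionDet (wilsonDirac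 (fundamentalRep (Fin 3)) U (reg.mcrit k + reg.a k * m f / reg.Zm k) 1)‖ ∂(wilsonMeasure (fundamentalRep (Fin 3)) (reg.β k))) / (∫ U : GaugeConfig 4 (2 * reg.L k + 1) ↥(Matrix.specialUnitaryGroup (Fin 3) ℂ), ∏ f : Fin Nf, ‖fermionDet (wilsonDirac (fundamentalRep (Fin 3)) U (reg.mcrit k + reg.a k * m f / reg.Zm k) 1)‖ ∂(wilsonMeasure (fundamentalRep (Fin 3)) (reg.β k)))) := by
    intro m hm
    refine ⟨fun ε hε => ?_, (hTm m hm).2⟩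
    have hd := hdeep m hm (ε / 8) (by positivity)
    have hn := (hTm m hm).1 (ε / 2) (half_pos hε)
    filter_upwards [hd, hn] with k hk hk' S hS
    have hkS := hk S hS
    have hk'S := hk' S hS
    rw [div_div] at hk'S
    refine ratio_le_of_split (wilsonMeasure (d := 4) (L := 2 * S + 1) (fundamentalRep (Fin 3)) (reg.β k))
      (A := fun U => ∑ f : Fin Nf, (Multiset.countP (fun z : ℂ => z.im = 0 ∧ z.re < -(reg.mcrit k + reg.a k * m f / reg.Zm k)) (wilsonDirac (fundamentalRep (Fin 3)) U 0 1).charpoly.roots : ℝ))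
      (D := fun U => (Multiset.countP (fun z : ℂ => 4 - c₁ / (2 * reg.β k) ≤ ‖(4 : ℂ) - z‖) (wilsonDirac (fundamentalRep (Fin 3)) U 0 1).charpoly.roots : ℝ))
      (N := fun U => ∑ f : Fin Nf, (Multiset.countP (fun z : ℂ => z.im = 0 ∧ c₁ / (2 * reg.β k) < z.re ∧ z.re < -(reg.mcrit k + reg.a k * m f / reg.Zm k)) (wilsonDirac (fundamentalRep (Fin 3)) U 0 1).charpoly.roots : ℝ))
      (w := fun U => ∏ f : Fin Nf, ‖fermionDet (wilsonDirac (fundamentalRep (Fin 3)) U (reg.mcrit k + reg.a k * m f / reg.Zm k) 1)‖)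
      (n := (Nf : ℝ)) (ε₁ := ε / 8) (ε₂ := ε / 2)
      (fun U => Finset.prod_nonneg fun f _ => norm_nonneg _)
      (fun U => Finset.sum_nonneg fun f _ => Nat.cast_nonneg _)
      (fun U => ?_) ?_ ?_ hkS hk'S (Nat.cast_nonneg _) (by positivity) hε.le ?_
    · -- pointwise split of the count, flavour by flavour
      have key : ∀ f : Fin Nf,
          (Multiset.countP (fun z : ℂ => z.im = 0 ∧ z.re < -(reg.mcrit k + reg.a k * m f / reg.Zm k)) (wilsonDirac (fundamentalRep (Fin 3)) U 0 1).charpoly.roots : ℝ) ≤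
            (Multiset.countP (fun z : ℂ => 4 - c₁ / (2 * reg.β k) ≤ ‖(4 : ℂ) - z‖) (wilsonDirac (fundamentalRep (Fin 3)) U 0 1).charpoly.roots : ℝ) +
              (Multiset.countP (fun z : ℂ => z.im = 0 ∧ c₁ / (2 * reg.β k) < z.re ∧ z.re < -(reg.mcrit k + reg.a k * m f / reg.Zm k)) (wilsonDirac (fundamentalRep (Fin 3)) U 0 1).charpoly.roots : ℝ) := by
        intro f
        exact_mod_cast countP_le_countP_add_countP _ _ _ _
          (fun z hz => realBelow_imp_deep_or_near _ _ z hz)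
      calc (∑ f : Fin Nf, (Multiset.countP (fun z : ℂ => z.im = 0 ∧ z.re < -(reg.mcrit k + reg.a k * m f / reg.Zm k)) (wilsonDirac (fundamentalRep (Fin 3)) U 0 1).charpoly.roots : ℝ))
          ≤ ∑ f : Fin Nf, ((Multiset.countP (fun z : ℂ => 4 - c₁ / (2 * reg.β k) ≤ ‖(4 : ℂ) - z‖) (wilsonDirac (fundamentalRep (Fin 3)) U 0 1).charpoly.roots : ℝ) +
              (Multiset.countP (fun z : ℂ => z.im = 0 ∧ c₁ / (2 * reg.β k) < z.re ∧ z.re < -(reg.mcrit k + reg.a k * m f / reg.Zm k)) (wilsonDirac (fundamentalRep (Fin 3)) U 0 1).charpoly.roots : ℝ)) :=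
            Finset.sum_le_sum fun f _ => key f
        _ = (Nf : ℝ) * (Multiset.countP (fun z : ℂ => 4 - c₁ / (2 * reg.β k) ≤ ‖(4 : ℂ) - z‖) (wilsonDirac (fundamentalRep (Fin 3)) U 0 1).charpoly.roots : ℝ) +
              ∑ f : Fin Nf, (Multiset.countP (fun z : ℂ => z.im = 0 ∧ c₁ / (2 * reg.β k) < z.re ∧ z.re < -(reg.mcrit k + reg.a k * m f / reg.Zm k)) (wilsonDirac (fundamentalRep (Fin 3)) U 0 1).charpoly.roots : ℝ) := by
            rw [Finset.sum_add_distrib, Finset.sum_const, Finset.card_univ, Fintype.card_fin, nsmul_eq_mul]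
    · -- integrability of the deep count × weight
      exact integrable_natCount_mul_weight (fun f => reg.mcrit k + reg.a k * m f / reg.Zm k) (reg.β k)
        (measurable_deepCount (2 * S + 1) (c₁ / (2 * reg.β k)))
        (fun U => countP_roots_charpoly_le_card _ _)
    · -- integrability of the near-edge counts × weight
      refine integrable_mul_weight (fun f => reg.mcrit k + reg.a k * m f / reg.Zm k) (reg.β k)
        (Finset.measurable_sum _ fun f _ => measurable_from_nat.comp
          (stub_countMeasurable.2 (2 * S + 1) (c₁ / (2 * reg.β k)) (-(reg.mcrit k + reg.a k * m f / reg.Zm k))))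
        (C := ∑ _f : Fin Nf, (Fintype.card (QuarkIdx (2 * S + 1)) : ℝ)) (fun U => ?_)
      rw [abs_of_nonneg (Finset.sum_nonneg fun f _ => by positivity)]
      exact Finset.sum_le_sum fun f _ => by exact_mod_cast countP_roots_charpoly_le_card _ _
    · -- ε-bookkeeping: `N_f ε/8 + ε/2 ≤ ε` for `N_f ≤ 3`
      have h3 : (Nf : ℝ) ≤ 3 := by exact_mod_cast hNf3
      nlinarith
  obtain ⟨M₁, hM₀₁, c, hc, hE⟩ := h₅ hW Nf hNf reg hms has hgr hbr M₀ hM₀ hTrunk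
  refine ⟨reg, hms, has, hcap, hbr, M₁, le_trans hM₀ hM₀₁, c, hc, fun m hm => ⟨hE m hm, ?_⟩⟩
  have hm' : ∀ f, M₀ < m f := fun f => lt_of_le_of_lt hM₀₁ (hm f)
  obtain ⟨η, hη, hT'⟩ := (hTm m hm').2
  exact ⟨η, hη, fun M hM => hT' M (lt_of_le_of_lt hM₀₁ hM)⟩

/-- **S1 + S2 + S3 + S4 + S5 + `WegnerEstimate` ⇒ the crux `WindowExtinction` (SD⁺), concluded BY NAME.**
The five stubs are used directly; the route item `WegnerEstimate` (stmt-QuantumFields-8966) is the only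
hypothesis (a registered obligation, consumed by the Wegner leaf S5 — the route's own closing edge
`TipPricing → WegnerEstimate → WindowExtinction`). -/
theorem WindowExtinction_of (hW : WegnerEstimate) : WindowExtinction :=
  windowExtinction_of_parts stub_schurCount stub_twoLineDecay stub_deepOfTwoLine stub_nearEdgeTightTrunk
    stub_coercivityLeaf hW

end Summit.QuantumFields.QCD.Cruxes.WindowExtinction.CornerDecorrelationDeepHole

end
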